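import Mathlib
import Summits.QuantumFields.QCD.Theorems.WilsonQuarkChessboardFlatCellOptimalStubLogDetDimFree
import Summits.QuantumFields.QCD.Theorems.QuarksAsStableActionCriticalLineDiamagnetismStubBlockEstimate

/-!
# Dimension-free uniform per-block determinant estimate
(helper for crux stmt-QuantumFields-9307 `FlatCellOptimal`, line `registered`, stub
`stub_localNormGain_of` (G4 transport), sub-goal `stub_blockEstimateDimFree`, wave 3)

Abstract finite-dimensional linear algebra over `ℂ` (no lattice objects).  For a COERCIVE square
matrix `B` (`h Σᵢ ‖vᵢ‖² ≤ Σᵢ ‖(B v)ᵢ‖²` for all `v`, `h > 0`) and a perturbation `Δ` with the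
Frobenius bound `Σᵢⱼ ‖Δᵢⱼ‖² ≤ Φ` and the operator bound `Σᵢ ‖(Δ v)ᵢ‖² ≤ α Σᵢ ‖vᵢ‖²`, writing
`R = B⁻¹ Δ` and `q = Re tr R − ½ Re tr R²`:

  `‖det (B + Δ)‖ ≤ ‖det B‖ · exp (q + 4 Φ √α · √h / h²)`.

This is the sibling crux stmt-QuantumFields-9734's `stub_blockEstimate`
(`Theorems/QuarksAsStableActionCriticalLineDiamagnetismStubBlockEstimate.lean`, error
`(8 √(nΦ) α + 2 Φ √α + 2 n α √α) · √h/h²`, `n = |ι|`) with the dimension `n` REMOVED: the two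
dimension-dependent inputs of the sibling (`stub_detPerturbIR`, `stub_logDetSecondOrder`) are
replaced by the landed dimension-free log-determinant bounds of G1
(`Theorems/WilsonQuarkChessboardFlatCellOptimalStubLogDetDimFree.lean`:
`LogDetDimFree.norm_det_one_add_le_of_opBound`, `LogDetDimFree.norm_det_one_add_le_exp_trace_add`).

Proof.  `B` is invertible (coercivity), `B + Δ = B (1 + R)`, `‖R‖_F² ≤ Φ/h`
(`BlockEstimate.frob_inv_mul_le`) and `Σᵢ ‖(R v)ᵢ‖² ≤ (α/h) Σᵢ ‖vᵢ‖²`.  Case split: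
* `h ≤ 4α` (infrared, `ir_case_dimFree`): G1 (b) gives `log ‖det (1 + R)‖ ≤ Re tr R + ‖R‖_F²/2
  = q + (Re tr R² + ‖R‖_F²)/2 ≤ q + ‖R‖_F² ≤ q + Φ/h` (`Re tr R² ≤ ‖R‖_F²`,
  `BlockEstimate.re_trace_mul_self_le`), and `Φ/h = Φ √h · (√h/h²) ≤ 2 Φ √α · (√h/h²)` since
  `√h ≤ 2 √α`.
* `4α ≤ h` (bulk, `bulk_case_dimFree`): `ρ = √(α/h) ≤ 1/2`, so G1 (a) gives
  `log ‖det (1 + R)‖ ≤ q + 2 ρ Φ/h = q + 2 Φ √α · (√h/h²)`.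
In either case `2 Φ √α · (√h/h²) ≤ 4 Φ √α · (√h/h²)`.

Pure theorem file (no definitions); Mathlib + the G1 file + the sibling BlockEstimate file (for its
abstract plumbing `frob_inv_mul_le`, `re_trace_mul_self_le`, `one_div_eq`, and, through it,
`StubDetPerturbIRAux.det_ne_zero_of_coercive` / `sum_norm_sq_inv_mulVec_le`).
-/

noncomputable section

open scoped BigOperators Matrix ComplexConjugate
open Finset

namespace Summit.QuantumFields.QCD.Cruxes.FlatCellOptimal

namespace BlockEstimate

open Matrix Complex
open Summit.QuantumFields.QCD.Cruxes.CriticalLineDiamagnetism.ChessboardCellGain.StubDetPerturbIRAux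
open Summit.QuantumFields.QCD.Cruxes.CriticalLineDiamagnetism.ChessboardCellGain.BlockEstimate
open Summit.QuantumFields.QCD.Cruxes.FlatCellOptimal.LogDetDimFree

variable {ι : Type} [Fintype ι] [DecidableEq ι]

/-- Power bookkeeping: `√(α/h) · (Φ/h) = Φ √α · (√h/h²)` for `α ≥ 0`, `h > 0`. -/
theorem sqrt_div_mul_div_eq {α h : ℝ} (Φ : ℝ) (hα : 0 ≤ α) (hh : 0 < h) :
    Real.sqrt (α / h) * (Φ / h) = Φ * Real.sqrt α * (Real.sqrt h / h ^ 2) := by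
  obtain ⟨s, hs, rfl⟩ : ∃ s : ℝ, 0 < s ∧ s ^ 2 = h :=
    ⟨Real.sqrt h, Real.sqrt_pos.mpr hh, Real.sq_sqrt hh.le⟩
  rw [Real.sqrt_div hα, Real.sqrt_sq hs.le]
  field_simp

/-- IR bookkeeping: for `0 < h ≤ 4α` and `Φ ≥ 0`, `Φ/h ≤ 2 Φ √α · (√h/h²)`
(`1/h = √h · (√h/h²)` and `√h ≤ 2 √α`). -/
theorem div_le_ir {h Φ α : ℝ} (hh : 0 < h) (hΦ : 0 ≤ Φ) (hα0 : 0 ≤ α) (hα : h ≤ 4 * α) :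
    Φ / h ≤ 2 * Φ * Real.sqrt α * (Real.sqrt h / h ^ 2) := by
  have hs2 : Real.sqrt h ≤ 2 * Real.sqrt α :=
    (sq_le_sq₀ (Real.sqrt_nonneg _) (by positivity)).mp
      (by rw [Real.sq_sqrt hh.le, mul_pow, Real.sq_sqrt hα0]; linarith)
  calc Φ / h = Φ * (1 / h) := by ring
    _ = Φ * (Real.sqrt h * (Real.sqrt h / h ^ 2)) := by rw [one_div_eq hh]
    _ ≤ Φ * (2 * Real.sqrt α * (Real.sqrt h / h ^ 2)) := by gcongr
    _ = 2 * Φ * Real.sqrt α * (Real.sqrt h / h ^ 2) := by ring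

/-- The factorisation `det (B + Δ) = det B · det (1 + B⁻¹ Δ)` for coercive (hence invertible) `B`. -/
theorem det_add_eq_of_coercive (B Δ : Matrix ι ι ℂ) {h : ℝ} (hh : 0 < h)
    (hB : ∀ v : ι → ℂ, h * ∑ i, ‖v i‖ ^ 2 ≤ ∑ i, ‖(B.mulVec v) i‖ ^ 2) :
    (B + Δ).det = B.det * (1 + B⁻¹ * Δ).det := by
  have hU : IsUnit B.det := isUnit_iff_ne_zero.mpr (det_ne_zero_of_coercive B hh hB)
  rw [← Matrix.det_mul, mul_add, mul_one, ← mul_assoc, Matrix.mul_nonsing_inv _ hU, one_mul]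

/-- **Infrared blocks** (`h ≤ 4α`), dimension-free:
`‖det (B + Δ)‖ ≤ ‖det B‖ · exp (q + 2 Φ √α · √h/h²)` from G1 (b)
(`‖det (1 + R)‖ ≤ exp (Re tr R + ‖R‖_F²/2)`), `Re tr R² ≤ ‖R‖_F² ≤ Φ/h`, and `div_le_ir`. -/
theorem ir_case_dimFree (B Δ : Matrix ι ι ℂ) {h Φ α : ℝ} (hh : 0 < h) (hΦ : 0 ≤ Φ)
    (hα0 : 0 ≤ α) (hα : h ≤ 4 * α)
    (hB : ∀ v : ι → ℂ, h * ∑ i, ‖v i‖ ^ 2 ≤ ∑ i, ‖(B.mulVec v) i‖ ^ 2)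
    (hF : ∑ i, ∑ j, ‖Δ i j‖ ^ 2 ≤ Φ) :
    ‖(B + Δ).det‖ ≤ ‖B.det‖ * Real.exp ((B⁻¹ * Δ).trace.re - (B⁻¹ * Δ * (B⁻¹ * Δ)).trace.re / 2
      + 2 * Φ * Real.sqrt α * (Real.sqrt h / h ^ 2)) := by
  have hRF : ∑ i, ∑ j, ‖(B⁻¹ * Δ) i j‖ ^ 2 ≤ Φ / h :=
    (frob_inv_mul_le B Δ hh hB).trans (div_le_div_of_nonneg_right hF hh.le)
  have hq2 : (B⁻¹ * Δ * (B⁻¹ * Δ)).trace.re ≤ Φ / h := (re_trace_mul_self_le _).trans hRF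
  have hLD := norm_det_one_add_le_exp_trace_add (B⁻¹ * Δ) hRF
  have har := div_le_ir hh hΦ hα0 hα
  rw [det_add_eq_of_coercive B Δ hh hB, norm_mul]
  refine mul_le_mul_of_nonneg_left (hLD.trans (Real.exp_le_exp.mpr ?_)) (norm_nonneg _)
  linarith

/-- **Bulk blocks** (`4α ≤ h`), dimension-free:
`‖det (B + Δ)‖ ≤ ‖det B‖ · exp (q + 2 Φ √α · √h/h²)` from G1 (a) with `ρ = √(α/h) ≤ 1/2`,
`F = Φ/h`, and `2 ρ F = 2 Φ √α · √h/h²` (`sqrt_div_mul_div_eq`). -/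
theorem bulk_case_dimFree (B Δ : Matrix ι ι ℂ) {h Φ α : ℝ} (hh : 0 < h) (hα0 : 0 ≤ α)
    (hα : 4 * α ≤ h) (hB : ∀ v : ι → ℂ, h * ∑ i, ‖v i‖ ^ 2 ≤ ∑ i, ‖(B.mulVec v) i‖ ^ 2)
    (hF : ∑ i, ∑ j, ‖Δ i j‖ ^ 2 ≤ Φ)
    (hΔ : ∀ v : ι → ℂ, ∑ i, ‖(Δ.mulVec v) i‖ ^ 2 ≤ α * ∑ i, ‖v i‖ ^ 2) :
    ‖(B + Δ).det‖ ≤ ‖B.det‖ * Real.exp ((B⁻¹ * Δ).trace.re - (B⁻¹ * Δ * (B⁻¹ * Δ)).trace.re / 2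
      + 2 * Φ * Real.sqrt α * (Real.sqrt h / h ^ 2)) := by
  have hρ0 : 0 ≤ Real.sqrt (α / h) := Real.sqrt_nonneg _
  have hρsq : Real.sqrt (α / h) ^ 2 = α / h := Real.sq_sqrt (div_nonneg hα0 hh.le)
  have hρhalf : Real.sqrt (α / h) ≤ 1 / 2 :=
    (sq_le_sq₀ hρ0 (by norm_num)).mp (by rw [hρsq, div_le_iff₀ hh]; linarith)
  have hR : ∀ v : ι → ℂ, ∑ i, ‖((B⁻¹ * Δ).mulVec v) i‖ ^ 2 ≤
      Real.sqrt (α / h) ^ 2 * ∑ i, ‖v i‖ ^ 2 := fun v => by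
    rw [hρsq, ← Matrix.mulVec_mulVec]
    calc ∑ i, ‖(B⁻¹ *ᵥ (Δ *ᵥ v)) i‖ ^ 2 ≤ (∑ i, ‖(Δ *ᵥ v) i‖ ^ 2) / h :=
          sum_norm_sq_inv_mulVec_le B hh hB _
      _ ≤ (α * ∑ i, ‖v i‖ ^ 2) / h := div_le_div_of_nonneg_right (hΔ v) hh.le
      _ = α / h * ∑ i, ‖v i‖ ^ 2 := by ring
  have hRF : ∑ i, ∑ j, ‖(B⁻¹ * Δ) i j‖ ^ 2 ≤ Φ / h :=
    (frob_inv_mul_le B Δ hh hB).trans (div_le_div_of_nonneg_right hF hh.le)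
  have hLD := norm_det_one_add_le_of_opBound (B⁻¹ * Δ) hρ0 hρhalf hR hRF
  have e : 2 * Real.sqrt (α / h) * (Φ / h) = 2 * Φ * Real.sqrt α * (Real.sqrt h / h ^ 2) := by
    rw [mul_assoc, sqrt_div_mul_div_eq Φ hα0 hh]
    ring
  rw [det_add_eq_of_coercive B Δ hh hB, norm_mul, ← e]
  exact mul_le_mul_of_nonneg_left hLD (norm_nonneg _)

end BlockEstimate

open BlockEstimate in
/-- **Dimension-free uniform per-block estimate** (sub-goal `stub_blockEstimateDimFree` of the
registered stub `stub_localNormGain_of`, G4, of the line `registered` of crux `FlatCellOptimal`).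
For a coercive block `B` (`h Σ‖vᵢ‖² ≤ Σ‖(Bv)ᵢ‖²`, `h > 0`) and a perturbation `Δ` with
`‖Δ‖_F² ≤ Φ` and `Σ‖(Δ v)ᵢ‖² ≤ α Σ‖vᵢ‖²`, with `R = B⁻¹Δ` and `q = Re tr R − ½ Re tr R²`:
`‖det (B + Δ)‖ ≤ ‖det B‖ · exp (q + 4 Φ √α · √h/h²)` — the sibling's `stub_blockEstimate` without
the dimension `|ι|`.  Case split `h ≤ 4α` (`BlockEstimate.ir_case_dimFree`, from G1 (b)) versus
`4α ≤ h` (`BlockEstimate.bulk_case_dimFree`, from G1 (a)); each case costs `2 Φ √α · √h/h² ≥ 0`. -/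
theorem stub_blockEstimateDimFree : ∀ {ι : Type} [Fintype ι] [DecidableEq ι] (B Δ : Matrix ι ι ℂ) (h Φ α : ℝ), 0 < h → 0 ≤ Φ → 0 ≤ α → (∀ v : ι → ℂ, h * ∑ i, ‖v i‖ ^ 2 ≤ ∑ i, ‖(B.mulVec v) i‖ ^ 2) → (∑ i, ∑ j, ‖Δ i j‖ ^ 2 ≤ Φ) → (∀ v : ι → ℂ, ∑ i, ‖(Δ.mulVec v) i‖ ^ 2 ≤ α * ∑ i, ‖v i‖ ^ 2) → ‖(B + Δ).det‖ ≤ ‖B.det‖ * Real.exp (((B⁻¹ * Δ).trace.re - ((B⁻¹ * Δ) * (B⁻¹ * Δ)).trace.re / 2) + 4 * Φ * Real.sqrt α * (Real.sqrt h / h ^ 2)) := by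
  intro ι _ _ B Δ h Φ α hh hΦ hα hB hF hΔ
  have hE : 0 ≤ 2 * Φ * Real.sqrt α * (Real.sqrt h / h ^ 2) := by positivity
  rcases le_or_gt h (4 * α) with hIR | hbulk
  · refine (ir_case_dimFree B Δ hh hΦ hα hIR hB hF).trans
      (mul_le_mul_of_nonneg_left (Real.exp_le_exp.mpr ?_) (norm_nonneg _))
    linarith
  · refine (bulk_case_dimFree B Δ hh hα hbulk.le hB hF hΔ).trans
      (mul_le_mul_of_nonneg_left (Real.exp_le_exp.mpr ?_) (norm_nonneg _))
    linarith

end Summit.QuantumFields.QCD.Cruxes.FlatCellOptimal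

end
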